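import Summits.Ventures.PercRepro.ExcessOneNonTightening

/-!
# The cover lemma: a minimal member inside a set, a non-tightening direction, and a covering member

**Lemma (UC)** (proofs/MINE1-theoremS.md Addendum 31, supplement 31). Let `K` be a family, `U` a set,
and `k ∈ K` a member inside `U` of minimum cardinality among the members inside `U`. If the
complement `U \ k` is a difference of two members and some `z ∈ U \ k` is a **non-tightening
direction** of `K` (`#(z-edges of K \\ K) = #(z-edges of K)`) with a nonempty partner family, then
some member of `K` contains `U` (`exists_superset_mem_of_min_mem_subset`).

*Proof.* Write `R = Rstar (partner z K)`. By Theorem (NT)(2a) (`inter_Rstar_mem_partner`) the set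
`k ∩ R` is a member inside `U`, so by minimality `k ∩ R = k`, i.e. `k ⊆ R`. The set `(U \ k).erase z`
lies in `diffsY z K`, which by Theorem (NT)(3) (`diffsY_eq_diffs_partner_of_nonTightening`) is
`partner z K \\ partner z K`; so `(U \ k).erase z = g \ g'` with `g` a partner member, and Theorem
(NT)(2b) (`union_Rstar_mem_partner`) makes `insert z (g ∪ R)` a member. It contains `U \ k` (through
`g` and `z`) and `k` (through `R`).

*Use.* In the END-1 residue of (RM*) with `Σ₀ = ∅` (supplement 31) the partner family `K` has a member
inside `ū`, the complement of the smallest such member is a difference (`Y = D(K)`), and every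
element of `ū` is a non-tightening direction with a nonempty partner family — so a member contains
`ū`, against `ū ∉ P`. Lemma (UC) needs no excess hypothesis at all.
-/

namespace PercRepro.MSTight

open Finset
open scoped FinsetFamily

variable {α : Type*} [DecidableEq α] [Fintype α]

/-- **Lemma (UC).** A member `k ⊆ U` of minimum size among the members inside `U`, whose complement
`U \ k` is a difference of members, together with a non-tightening direction `z ∈ U \ k` having a
nonempty partner family, forces a member containing `U`. -/
theorem exists_superset_mem_of_min_mem_subset {K : Finset (Finset α)} {U k : Finset α}
    (hk : k ∈ K) (hkU : k ⊆ U) (hmin : ∀ k' ∈ K, k' ⊆ U → k.card ≤ k'.card)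
    (hA : U \ k ∈ K \\ K) {z : α} (hz : z ∈ U \ k)
    (hε : (diffsX z K ∩ diffsY z K).card = (partner z K).card) (hK : (partner z K).Nonempty) :
    ∃ m ∈ K, U ⊆ m := by
  set R := Rstar (partner z K) with hR
  obtain ⟨hzU, hzk⟩ := mem_sdiff.1 hz
  -- (2a): `k ∩ R` is a member inside `U`, hence equals `k` by minimality
  have h1 : k ∩ R ∈ partner z K :=
    inter_Rstar_mem_partner hε hK (mem_part0.2 ⟨hk, hzk⟩)
  have h1K : k ∩ R ∈ K := mem_of_mem_partner h1
  have hkR : k ⊆ R := by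
    have hsub : k ∩ R ⊆ k := inter_subset_left
    have hcard : k.card ≤ (k ∩ R).card := hmin _ h1K (hsub.trans hkU)
    have heq : k ∩ R = k := eq_of_subset_of_card_le hsub hcard
    intro x hx
    have : x ∈ k ∩ R := by rw [heq]; exact hx
    exact (mem_inter.1 this).2
  -- (3): `(U \ k).erase z` is a difference of two partner members
  have h2 : (U \ k).erase z ∈ diffsY z K := by
    refine mem_diffsY_iff.2 ⟨notMem_erase z _, ?_⟩
    rwa [insert_erase hz]
  rw [diffsY_eq_diffs_partner_of_nonTightening hε hK] at h2
  obtain ⟨g, hg, g', _, hgg'⟩ := mem_diffs.1 h2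
  -- (2b): `insert z (g ∪ R)` is a member
  have hg' : g ∈ partr z K := by
    obtain ⟨_, hzg, hgz⟩ := mem_partner_iff.1 hg
    exact mem_partr.2 ⟨hzg, hgz⟩
  have h3 : g ∪ R ∈ partner z K := union_Rstar_mem_partner hε hK hg'
  refine ⟨insert z (g ∪ R), (mem_partner_iff.1 h3).2.2, fun x hx => ?_⟩
  by_cases hxz : x = z
  · exact hxz ▸ mem_insert_self _ _
  · refine mem_insert_of_mem (mem_union.2 ?_)
    by_cases hxk : x ∈ k
    · exact Or.inr (hkR hxk)
    · left
      have : x ∈ g \ g' := hgg' ▸ mem_erase.2 ⟨hxz, mem_sdiff.2 ⟨hx, hxk⟩⟩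
      exact (mem_sdiff.1 this).1

/-- **Lemma (UC′), the variant without minimality.** If a set `k` lies inside the addable part
`Rstar (partner z K)` of a non-tightening direction `z ∈ U \ k` with a nonempty partner family, and
`U \ k` is a difference of members, then some member contains `U`. (Lemma (UC) is the case where
`k ⊆ Rstar` comes from minimality through `inter_Rstar_mem_partner`.) -/
theorem exists_superset_mem_of_subset_Rstar {K : Finset (Finset α)} {U k : Finset α}
    (hA : U \ k ∈ K \\ K) {z : α} (hz : z ∈ U \ k)
    (hε : (diffsX z K ∩ diffsY z K).card = (partner z K).card) (hK : (partner z K).Nonempty)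
    (hkR : k ⊆ Rstar (partner z K)) : ∃ m ∈ K, U ⊆ m := by
  set R := Rstar (partner z K) with hR
  obtain ⟨hzU, hzk⟩ := mem_sdiff.1 hz
  have h2 : (U \ k).erase z ∈ diffsY z K := by
    refine mem_diffsY_iff.2 ⟨notMem_erase z _, ?_⟩
    rwa [insert_erase hz]
  rw [diffsY_eq_diffs_partner_of_nonTightening hε hK] at h2
  obtain ⟨g, hg, g', _, hgg'⟩ := mem_diffs.1 h2
  have hg' : g ∈ partr z K := by
    obtain ⟨_, hzg, hgz⟩ := mem_partner_iff.1 hg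
    exact mem_partr.2 ⟨hzg, hgz⟩
  have h3 : g ∪ R ∈ partner z K := union_Rstar_mem_partner hε hK hg'
  refine ⟨insert z (g ∪ R), (mem_partner_iff.1 h3).2.2, fun x hx => ?_⟩
  by_cases hxz : x = z
  · exact hxz ▸ mem_insert_self _ _
  · refine mem_insert_of_mem (mem_union.2 ?_)
    by_cases hxk : x ∈ k
    · exact Or.inr (hkR hxk)
    · left
      have : x ∈ g \ g' := hgg' ▸ mem_erase.2 ⟨hxz, mem_sdiff.2 ⟨hx, hxk⟩⟩
      exact (mem_sdiff.1 this).1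

end PercRepro.MSTight
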